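import Summits.QuantumFields.BalabanUV.Beta.GAN24.SourcePairingLevelOneSectors
import Summits.QuantumFields.BalabanUV.Beta.GAN24.WilsonSectorSourcePairingZero
import Summits.QuantumFields.BalabanUV.Beta.GAN24.BorderSectorSourcePairingSucc
import Summits.QuantumFields.BalabanUV.Beta.GAN24.MultiplierVertexBondSum

/-!
# `BalabanUV.Beta.GAN24.SourcePairingLevelOneClosed` — binder row G-an2-4 ∕ (CONV-C), the (S) row ∕ (W-γ) one level up, the (η) step at the base, PART 2:
# **THE SOURCE PAIRING AT LEVEL ONE IN CLOSED FORM AT BAŁABAN's PINS — `X_1(colH G_1(ν,y′); n, 1_{B(y₀)}) = −½·⟨1⁺_{B(y₀)}⊙colH G_1(ν,y′), C_0 n⟩ + ¼·⟨C_0 colH G_1(ν,y′), σ_{1_{B(y₀)}}⊙n⟩`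
# for every bounded `Lc`-periodic `n` (`Lc` odd, centred root, `cE = Lc^{d+1}`, `cVH = −Lc^{d+1}·½·Lc^{d+1}`, every `cΛ`)**
# (G-an2-4 CRUX TEAM (2), seat `b2b-balaban-gan24-formalise-leaf-06` = the (γ) hand, gen 50, INTENT 3, PART 2)

NOT IN PRINT; OUR BOOKKEEPING ([folklore] assembly BY NAME of TODAY's PART 1 `SourcePairingLevelOneSectors.slotSum_S0NAt_eq_sectors` (the three sectors), leaf-02 g61's PART 4b
`WilsonSectorSourcePairingZero.hasSum_prod_gaugeLeg_e3OfK_wilsonA_zero_ctr` (the Wilson sector per slot, with the per-slot `(C1′)` and `(C2′)` defects explicit) and PART 2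
`BorderSectorSourcePairingSucc.hasSum_prod_gaugeLeg_e3OfK_vhSAt` (the border sector per slot = `cH_0·Lc^{−(d+1)}·(C1′)`), TODAY's `LambdaSectorSourcePairingZero.lambdaSector_twoLevel_eq_zero`
(the Lagrange sector vanishes) and leaf-06 g49's (δ2b) `TwoLevelDefectVanishing.twoLevel_defect_eq_zero` (`(C2′) = 0`); the multiplier columns by `KernelWardMColumn.colM_coDressKBmAt` ⨾
`MultiplierZeroMass.colM_KInvStep` ⨾ `TransverseDictionary.wΦ_symm`; 0 `def`, 0 cited fact, 0 `def … : Prop`, 0 sorry).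
HONEST FRAMING (cell contract, verbatim): «discharging `BetaPertH` makes Bałaban's UV stability UNCONDITIONAL — a real constructive-QFT result; it is NOT the continuum limit and NOT
the Clay problem.»  HONEST DEPENDENCY (verbatim): «continuum YM on T⁴ ⇐ BetaPertH ∧ nine spine estimates (0/9 proved); BetaPertH ⇐ (D1) ∧ (D4) ∧ CAP+tail; G-an2-4 gates asym,
D1 and NE2/3/4.»

WHY (leaf-06 g49 R1 ∕ ENGINE E31 §(B), memo `HOME/b2b-balaban-gan24-formalise-leaf-06/g49/E30-E31-CENSUS.md`).  With `h = colH G_1(ν,y′)`, per slot `(l,t)` of `G_0`: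
Wilson sector `W = cH_0·[−½(s_0⁻¹·φ(t+e_l)·(C_0 n)(l,t) − (C1′)_{lt}) + ¼(s_0⁻¹·Mσ_{lt} + (C2′)_{lt})]` (PART 4b), border sector `V = cH_0·Lc^{−(d+1)}·(C1′)_{lt}` (PART 2; the two `(C1′)`
objects agree because the multiplier column of `G_0` is `wΦ_{Lc}`, symmetric under the exchange of its two coarse bonds — leaf-02 g61's PART 4a `colM_coDressKBmAt_KInvStep_swap`), so AT THE PINS `cE = Lc^{d+1}`, `cVH = −½Lc^{2(d+1)}`
the `(C1′)` coefficient `cH_0·(½cE + cVH·Lc^{−(d+1)})` VANISHES identically and `cE·W + cVH·V = −½·φ(t+e_l)·(C_0 n)(l,t) + ¼·Mσ_{lt} + ¼·(C2′)_{lt}` (`cH_0·cE = s_0⁻¹ = 1`); the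
Lagrange sector contributes `0` for two-level data (PART B of INTENT 1).  Summing against `h` (two Fubini steps on absolutely summable slot × bond families, §2): the `Mσ` slot sum is
`⟨C_0 h, σ_φ⊙n⟩`, the `(C2′)` slot sum is (δ2b)'s `Σ'_Y Σ_κ dφ·(BO − EI)(H_0 n)·(C_0 h) = 0` once `C_0 h` is written through `wΦ_{Lc}` (§2 `slotSum_mul_colM_eq`).  HENCE THE CLOSED FORM.
ROAD-P2's `hX` AT `j = 0` is this identity at `n := n⋆` (`ExplicitSourceFormPeriodic` supplies the two hypotheses), after `⟨C_0 h, σ_φ⊙n⋆⟩ = 0` ((E3) + adjointness + (ΛS) §3) and the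
identification of `(C_0 n⋆)` with `hX`'s displayed exit⊗exit charge — NOT in this file (PART 3).
* §1 `abs_multResponse_le`, `abs_boxSum_ite_le`, `slotSum_mul_colM_eq` (`Σ_l Σ'_t h l t·colM G_j Lc l t κ Y = Σ'_t Σ_l wΦ_{Lc^{j+1}} κ l (Y − t)·h l t`).
* §2 `summable_slot_mul_tsum_sum`, **`slotSum_tsum_sum_mul_eq`** (the slot × bond Fubini for a column decaying in fine units against a bounded bond weight).
* §3 **`sourcePairing_levelOne_closed`** — the statement in the title.
Asserts NO value of any resolvent column beyond the inputs named; NOTHING of `hX` itself ∕ (W-γ) at levels ≥ 1 ∕ (INV) ∕ (Π) ∕ (S) discharged by this file (it is the level-ONE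
identity for GENERIC periodic data, one level of road-P2's `hX` modulo PART 3's specialisation); NEVER «G-an2-4 closed» as (CONV-C); NOT D1, NOT `BetaPertH`, NOT continuum, NOT Clay.
2026-08-23; no existing file touched.
-/

noncomputable section

open Finset
open scoped BigOperators
open Literature.MathematicalPhysics.QuantumFieldTheory
open Literature.MathematicalPhysics.QuantumFieldTheory.Balaban1983to89
open Literature.MathematicalPhysics.QuantumFieldTheory.Balaban1983to89.Beta
open B12Sec2to5 (l1 l1_nonneg)
open ExpKernelCalculus (Site MKer Decays Zl Zl_nonneg summable_exp_shift' tsum_exp_shift')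
open OneStepResolventKernel (Fib LocStencil)
open AffineAveraging (Form1 box toSite unitVec dz)
open AveragingContours (blk)
open AveragingContoursRooted (ctrOff ctrOff_mem_box)
open AveragingHessianKernelsRooted (vhSAt locStencil_vhSAt hessFFAt)
open InterLevelTransport (SLam)
open KernelSpecInstance (wΦ)
open StepJetData (wilsonA locStencil_wilsonA)
open OneStepKernelFamily (KInvStep colH)
open SecondOrderResponse (colM)
open BalabanStepJetsSucc (E2 lamCoeffK)
open Summit.QuantumFields.BalabanUV.Beta.AxialDressingRooted (coDressKBmAt decays_coDressKBmAt_KInvStep one_le_of_neZero)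
open Summit.QuantumFields.BalabanUV.Beta.BorderedHessian (stepScale)
open Summit.QuantumFields.BalabanUV.Beta.KernelWardLevels (stepScale_zero)
open Summit.QuantumFields.BalabanUV.Beta.SpineRooted (S0NAt e3OfK locStencil_e3OfK)
open Summit.QuantumFields.BalabanUV.Beta.KernelWardMColumn (colM_coDressKBmAt)
open Summit.QuantumFields.BalabanUV.Beta.GAN24.MultiplierZeroMass (colM_KInvStep)
open Summit.QuantumFields.BalabanUV.Beta.GAN24.MultiplierVertexBondSum (abs_colM_le_fine)
open Summit.QuantumFields.BalabanUV.Beta.GAN24.TransverseDictionary (wΦ_symm)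
open Summit.QuantumFields.BalabanUV.Beta.GAN24.CoarseGaugeSourceResponse (summable_bdd_mul)
open Summit.QuantumFields.BalabanUV.Beta.GAN24.CubicPushGaugeLegUnfolding (summable_weight_col)
open Summit.QuantumFields.BalabanUV.Beta.GAN24.ChargeTowerClimb (summable_colH)
open Summit.QuantumFields.BalabanUV.Beta.GAN24.CubicPushGaugeLegUnfoldingFF (abs_fieldResponse_le')
open Summit.QuantumFields.BalabanUV.Beta.GAN24.CubicSectorLevelDown (summable_uncurry_mul_decay_mul_bdd)
open Summit.QuantumFields.BalabanUV.Beta.GAN24.LambdaMemberPairing (locStencil_SLam_lamCoeffK)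
open Summit.QuantumFields.BalabanUV.Beta.GAN24.LambdaSectorSourcePairingZero (lambdaSector_twoLevel_eq_zero)
open Summit.QuantumFields.BalabanUV.Beta.GAN24.SourcePairingLevelOneSectors (slotSum_S0NAt_eq_sectors summable_slot_mul_legPairing)
open Summit.QuantumFields.BalabanUV.Beta.GAN24.WilsonSectorSourcePairingZero (hasSum_prod_gaugeLeg_e3OfK_wilsonA_zero_ctr)
open Summit.QuantumFields.BalabanUV.Beta.GAN24.WilsonSectorGaugeLegUnfolding (colM_coDressKBmAt_KInvStep_swap)
open Summit.QuantumFields.BalabanUV.Beta.GAN24.BorderSectorSourcePairingSucc (hasSum_prod_gaugeLeg_e3OfK_vhSAt)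
open Summit.QuantumFields.BalabanUV.Beta.GAN24.TwoLevelDefectVanishing (twoLevel_defect_eq_zero)

namespace Summit.QuantumFields.BalabanUV.Beta.GAN24.SourcePairingLevelOneClosed

variable {d : ℕ} {Lc : ℕ} [NeZero Lc]

/-! ## §1 Multiplier columns: exchange symmetry, the multiplier response is bounded, box sums, the `wΦ` letters -/

/-- [folklore] **THE MULTIPLIER RESPONSE OF BOUNDED DATA IS BOUNDED** (in-block root, every `j`): `|Σ_κ₀ Σ'_u n κ₀ u·colM G_j Lc κ₀ u κ Y| ≤ BC` uniformly in `(κ, Y)`, and every summand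
family is summable (PART 1's `summable_weight_col` on the multiplier rows). -/
theorem abs_multResponse_le {r : Fin (d + 1) → ℕ} (hr : r ∈ box (d + 1) Lc) (j : ℕ) {n : Form1 (d + 1) ℝ} {Bn : ℝ} (hn : ∀ κ u, |n κ u| ≤ Bn) :
    ∃ BC : ℝ, 0 ≤ BC ∧ ∀ (κ : Fin (d + 1)) (Y : Site (d + 1)),
      (∀ κ₀, Summable fun u : Site (d + 1) => n κ₀ u * colM (coDressKBmAt (toSite r) Lc (KInvStep (d := d) Lc j)) Lc κ₀ u κ Y) ∧
      |∑ κ₀, ∑' u : Site (d + 1), n κ₀ u * colM (coDressKBmAt (toSite r) Lc (KInvStep (d := d) Lc j)) Lc κ₀ u κ Y| ≤ BC := by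
  obtain ⟨δG, CG, hδG, hCG, hG⟩ := decays_coDressKBmAt_KInvStep (d := d) hr j
  set G : MKer (d + 1) (Fib d) := coDressKBmAt (toSite r) Lc (KInvStep (d := d) Lc j) with hGdef
  have hBn : 0 ≤ Bn := (abs_nonneg _).trans (hn 0 0)
  set T : ℝ := Real.exp (δG * ((Lc : ℝ) * (d + 1))) * Zl (d + 1) δG with hT
  have hT0 : 0 ≤ T := by rw [hT]; have := Zl_nonneg (D := d + 1) hδG; positivity
  refine ⟨((d + 1 : ℕ) : ℝ) * (Bn * CG * T), by positivity, fun κ Y => ?_⟩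
  have hk : ∀ κ₀, (Summable fun u : Site (d + 1) => n κ₀ u * colM G Lc κ₀ u κ Y) ∧ |∑' u : Site (d + 1), n κ₀ u * colM G Lc κ₀ u κ Y| ≤ Bn * CG * T := by
    intro κ₀
    have h := summable_weight_col (N := Lc) hG hδG (ω := n κ₀) (fun u => hn κ₀ u) ((Lc : ℤ) • Y) (Sum.inr κ) (Sum.inr κ₀)
    have e : (fun z : Site (d + 1) => G ((Lc : ℤ) • Y) ((Lc : ℤ) • z) (Sum.inr κ) (Sum.inr κ₀) * n κ₀ z) = fun u => n κ₀ u * colM G Lc κ₀ u κ Y := by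
      funext u; rw [mul_comm]; rfl
    rw [e] at h
    exact h
  refine ⟨fun κ₀ => (hk κ₀).1, (Finset.abs_sum_le_sum_abs _ _).trans ?_⟩
  calc ∑ κ₀, |∑' u : Site (d + 1), n κ₀ u * colM G Lc κ₀ u κ Y| ≤ ∑ _κ₀ : Fin (d + 1), Bn * CG * T := Finset.sum_le_sum fun κ₀ _ => (hk κ₀).2
    _ = _ := by simp only [Finset.sum_const, Finset.card_univ, Fintype.card_fin, nsmul_eq_mul]

omit [NeZero Lc] in
/-- [folklore] A double finite sum of guarded bounded terms is bounded by the number of terms times the bound. -/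
theorem abs_boxSum_ite_le {S : Finset (Fin (d + 1) → ℕ)} {T : Finset ℕ} (p : (Fin (d + 1) → ℕ) → ℕ → Prop) [∀ b s, Decidable (p b s)]
    (F : (Fin (d + 1) → ℕ) → ℕ → ℝ) {B : ℝ} (hB : 0 ≤ B) (hF : ∀ b s, |F b s| ≤ B) :
    |∑ b ∈ S, ∑ s ∈ T, (if p b s then F b s else 0)| ≤ S.card * (T.card * B) := by
  refine (Finset.abs_sum_le_sum_abs _ _).trans ?_
  have h1 : ∀ b ∈ S, |∑ s ∈ T, (if p b s then F b s else 0)| ≤ T.card * B := fun b _ => by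
    refine (Finset.abs_sum_le_sum_abs _ _).trans ?_
    have h2 : ∀ s ∈ T, |(if p b s then F b s else 0)| ≤ B := fun s _ => by
      by_cases hp : p b s
      · rw [if_pos hp]; exact hF b s
      · rw [if_neg hp, abs_zero]; exact hB
    calc ∑ s ∈ T, |(if p b s then F b s else 0)| ≤ ∑ _s ∈ T, B := Finset.sum_le_sum h2
      _ = T.card * B := by rw [Finset.sum_const, nsmul_eq_mul]
  calc ∑ b ∈ S, |∑ s ∈ T, (if p b s then F b s else 0)| ≤ ∑ _b ∈ S, (T.card : ℝ) * B := Finset.sum_le_sum h1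
    _ = S.card * (T.card * B) := by rw [Finset.sum_const, nsmul_eq_mul]

/-- [folklore] **THE MULTIPLIER RESPONSE OF A DIRECTION-WISE SUMMABLE SLOT DATUM, IN THE `wΦ` LETTERS** (any root, every `j`, every multiplier bond `(κ, Y)`):
`Σ_l Σ'_t h l t·colM G_j Lc l t κ Y = Σ'_t Σ_l wΦ_{Lc^{j+1}} κ l (Y − t)·h l t` — (δ2b)'s `C_j h`. -/
theorem slotSum_mul_colM_eq {r : Fin (d + 1) → ℕ} (hr : r ∈ box (d + 1) Lc) (j : ℕ) {h : Form1 (d + 1) ℝ} (hh : ∀ l, Summable (h l))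
    (κ : Fin (d + 1)) (Y : Site (d + 1)) :
    ∑ l, ∑' t : Site (d + 1), h l t * colM (coDressKBmAt (toSite r) Lc (KInvStep (d := d) Lc j)) Lc l t κ Y
      = ∑' t : Site (d + 1), ∑ l, wΦ (N := Lc ^ (j + 1)) κ l (Y - t) * h l t := by
  obtain ⟨δG, CG, hδG, hCG, hG⟩ := decays_coDressKBmAt_KInvStep (d := d) hr j
  have hs : ∀ l, Summable fun t : Site (d + 1) => h l t * colM (coDressKBmAt (toSite r) Lc (KInvStep (d := d) Lc j)) Lc l t κ Y := fun l =>
    (summable_bdd_mul (hh l) (fun t => (abs_colM_le_fine (N := Lc) hG hδG.le l t κ Y).trans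
      (mul_le_of_le_one_right hCG (by rw [Real.exp_le_one_iff]; have := l1_nonneg (Y - t); nlinarith)))).congr fun t => by ring
  rw [← Summable.tsum_finsetSum (fun l _ => hs l)]
  refine tsum_congr fun t => Finset.sum_congr rfl fun l _ => ?_
  rw [colM_coDressKBmAt, colM_KInvStep, mul_comm]

/-! ## §2 The slot × bond Fubini -/

section Fubini

variable {r : Fin (d + 1) → ℕ}

/-- [folklore] **SLOT × BOND FUBINI, SUMMABILITY HALF**: for a column `c l t κ Y` decaying in FINE units `|c| ≤ C·e^{−δ|Y − t|₁}`, a direction-wise summable `h` and a bounded bond weight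
`w`, every slot family `t ↦ h l t·Σ'_Y Σ_κ c l t κ Y·w κ Y` is summable. -/
theorem summable_slot_mul_tsum_sum {c : Fin (d + 1) → Site (d + 1) → Fin (d + 1) → Site (d + 1) → ℝ} {C δ : ℝ} (hδ : 0 < δ) (hC : 0 ≤ C)
    (hc : ∀ l t κ Y, |c l t κ Y| ≤ C * Real.exp (-δ * l1 (Y - t))) {h : Form1 (d + 1) ℝ} (hh : ∀ l, Summable (h l))
    {w : Form1 (d + 1) ℝ} {B : ℝ} (hw : ∀ κ Y, |w κ Y| ≤ B) (l : Fin (d + 1)) :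
    Summable fun t : Site (d + 1) => h l t * ∑' Y : Site (d + 1), ∑ κ, c l t κ Y * w κ Y := by
  have hB : 0 ≤ B := (abs_nonneg _).trans (hw 0 0)
  have hF : ∀ κ, Summable (Function.uncurry fun (t : Site (d + 1)) (Y : Site (d + 1)) => h l t * (c l t κ Y * w κ Y)) := fun κ =>
    summable_uncurry_mul_decay_mul_bdd (d := d) hδ hC hB (1 : ℤ) (hh l) (c := fun t Y => c l t κ Y)
      (fun t Y => by rw [one_zsmul]; exact hc l t κ Y) (w := fun Y => w κ Y) (fun Y => hw κ Y)
  have hsum : Summable (Function.uncurry fun (t : Site (d + 1)) (Y : Site (d + 1)) => ∑ κ, h l t * (c l t κ Y * w κ Y)) := by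
    have := summable_sum (s := (Finset.univ : Finset (Fin (d + 1)))) fun κ _ => hF κ
    refine this.congr fun p => ?_
    obtain ⟨t, Y⟩ := p
    simp only [Function.uncurry_apply_pair]
  have h1 : Summable fun t : Site (d + 1) => ∑' Y : Site (d + 1), ∑ κ, h l t * (c l t κ Y * w κ Y) := by
    simpa only [Function.uncurry_apply_pair] using hsum.prod
  refine h1.congr fun t => ?_
  rw [← tsum_mul_left]
  refine tsum_congr fun Y => ?_
  rw [Finset.mul_sum]

/-- NOT IN PRINT; OUR BOOKKEEPING.  **SLOT × BOND FUBINI**: under the same hypotheses,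
`Σ_l Σ'_t h l t·Σ'_Y Σ_κ c l t κ Y·w κ Y = Σ'_Y Σ_κ (Σ_l Σ'_t h l t·c l t κ Y)·w κ Y` (absolutely summable slot × bond families, `Summable.tsum_comm`). -/
theorem slotSum_tsum_sum_mul_eq {c : Fin (d + 1) → Site (d + 1) → Fin (d + 1) → Site (d + 1) → ℝ} {C δ : ℝ} (hδ : 0 < δ) (hC : 0 ≤ C)
    (hc : ∀ l t κ Y, |c l t κ Y| ≤ C * Real.exp (-δ * l1 (Y - t))) {h : Form1 (d + 1) ℝ} (hh : ∀ l, Summable (h l))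
    {w : Form1 (d + 1) ℝ} {B : ℝ} (hw : ∀ κ Y, |w κ Y| ≤ B) :
    ∑ l, ∑' t : Site (d + 1), h l t * ∑' Y : Site (d + 1), ∑ κ, c l t κ Y * w κ Y
      = ∑' Y : Site (d + 1), ∑ κ, (∑ l, ∑' t : Site (d + 1), h l t * c l t κ Y) * w κ Y := by
  classical
  have hB : 0 ≤ B := (abs_nonneg _).trans (hw 0 0)
  have hF : ∀ l κ, Summable (Function.uncurry fun (t : Site (d + 1)) (Y : Site (d + 1)) => h l t * (c l t κ Y * w κ Y)) := fun l κ =>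
    summable_uncurry_mul_decay_mul_bdd (d := d) hδ hC hB (1 : ℤ) (hh l) (c := fun t Y => c l t κ Y)
      (fun t Y => by rw [one_zsmul]; exact hc l t κ Y) (w := fun Y => w κ Y) (fun Y => hw κ Y)
  have hs_tY : ∀ l κ t, Summable fun Y : Site (d + 1) => h l t * (c l t κ Y * w κ Y) := fun l κ t => by
    simpa only [Function.uncurry_apply_pair] using (hF l κ).prod_factor t
  have hs_t : ∀ l κ, Summable fun t : Site (d + 1) => ∑' Y : Site (d + 1), h l t * (c l t κ Y * w κ Y) := fun l κ => by
    simpa only [Function.uncurry_apply_pair] using (hF l κ).prod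
  have hs_Y : ∀ l κ, Summable fun Y : Site (d + 1) => ∑' t : Site (d + 1), h l t * (c l t κ Y * w κ Y) := fun l κ => by
    simpa only [Function.uncurry_apply_pair, Prod.swap_prod_mk] using (hF l κ).prod_symm.prod
  have hs_Yt : ∀ l κ Y, Summable fun t : Site (d + 1) => h l t * (c l t κ Y * w κ Y) := fun l κ Y => by
    simpa only [Function.uncurry_apply_pair, Prod.swap_prod_mk] using (hF l κ).prod_symm.prod_factor Y
  -- per direction `l`: push `h l t` inside, exchange `Σ'_Y` with `Σ_κ`, then `(t, Y)` Fubini per `κ`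
  have e1 : ∀ l, (∑' t : Site (d + 1), h l t * ∑' Y : Site (d + 1), ∑ κ, c l t κ Y * w κ Y)
      = ∑ κ, ∑' Y : Site (d + 1), ∑' t : Site (d + 1), h l t * (c l t κ Y * w κ Y) := by
    intro l
    have e : ∀ t : Site (d + 1), h l t * (∑' Y : Site (d + 1), ∑ κ, c l t κ Y * w κ Y) = ∑ κ, ∑' Y : Site (d + 1), h l t * (c l t κ Y * w κ Y) := by
      intro t
      rw [← tsum_mul_left, ← Summable.tsum_finsetSum (fun κ _ => hs_tY l κ t)]
      refine tsum_congr fun Y => ?_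
      rw [Finset.mul_sum]
    calc (∑' t : Site (d + 1), h l t * ∑' Y : Site (d + 1), ∑ κ, c l t κ Y * w κ Y)
        = ∑' t : Site (d + 1), ∑ κ, ∑' Y : Site (d + 1), h l t * (c l t κ Y * w κ Y) := tsum_congr e
      _ = ∑ κ, ∑' t : Site (d + 1), ∑' Y : Site (d + 1), h l t * (c l t κ Y * w κ Y) := Summable.tsum_finsetSum (fun κ _ => hs_t l κ)
      _ = ∑ κ, ∑' Y : Site (d + 1), ∑' t : Site (d + 1), h l t * (c l t κ Y * w κ Y) :=
          Finset.sum_congr rfl fun κ _ => ((hF l κ).tsum_comm).symm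
  rw [Finset.sum_congr rfl fun l _ => e1 l, Finset.sum_comm]
  -- `Σ_κ Σ_l Σ'_Y Σ'_t = Σ'_Y Σ_κ Σ_l Σ'_t`
  have e2 : ∀ κ, (∑ l, ∑' Y : Site (d + 1), ∑' t : Site (d + 1), h l t * (c l t κ Y * w κ Y))
      = ∑' Y : Site (d + 1), ∑ l, ∑' t : Site (d + 1), h l t * (c l t κ Y * w κ Y) := fun κ =>
    (Summable.tsum_finsetSum (fun l _ => hs_Y l κ)).symm
  rw [Finset.sum_congr rfl fun κ _ => e2 κ, ← Summable.tsum_finsetSum (fun κ _ => summable_sum fun l _ => hs_Y l κ)]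
  refine tsum_congr fun Y => Finset.sum_congr rfl fun κ _ => ?_
  rw [Finset.sum_mul]
  refine Finset.sum_congr rfl fun l _ => ?_
  rw [← tsum_mul_right]
  exact tsum_congr fun t => by ring

end Fubini

/-! ## §3 The level-one closed form at the pins -/

/-- NOT IN PRINT; OUR BOOKKEEPING.  **THE SOURCE PAIRING AT LEVEL ONE IN CLOSED FORM AT BAŁABAN's PINS** (`Lc` odd, centred root `ρ = toSite (ctrOff (d+1) Lc)`, `cE = Lc^{d+1}`,
`cVH = −(Lc^{d+1}·½·Lc^{d+1})` as in leaf-10's `WardLocusRecursive.hSd_SrecAt`, EVERY Λ-weight `cΛ`, every slot `(ν, y′)` of `G_1`, every bounded `Lc`-periodic `n`, every block label `y₀`;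
`G_j = coDressKBmAt ρ Lc (KInvStep Lc j)`, `h = colH G_1 Lc ν y′`, `φ = 1_{blk · = y₀}`, `(C_0 n)(l,t) = Σ_κ₀ Σ'_u n κ₀ u·colM G_0 Lc κ₀ u l t`, `(C_0 h)(κ,Y) = Σ_l Σ'_t h l t·colM G_0 Lc l t κ Y`):
`Σ_l Σ'_t h l t·Σ'_{(u,x)} Σ_κκ₂ n κ u·dzφ κ₂ x·e3OfK Lc G_0 (S0NAt ρ cE cVH cΛ) l t u x (inl κ)(inl κ₂) = −½·Σ_l Σ'_t h l t·(φ(t+e_l)·(C_0 n)(l,t)) + ¼·Σ'_Y Σ_κ (C_0 h)(κ,Y)·((φ Y + φ(Y+e_κ))·n κ Y)`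
— E29∕E31's closed form of `X_1` («`cE·cH_0·[−½⟨ψ⁺h, E2_1 n⟩ + ¼⟨σ_ψ n, E2_1 h⟩]`», `E2_1 = C_0`) AS A THEOREM: the three sectors (PART 1), the Wilson and border sectors per slot
(leaf-02 PART 4b ∕ PART 2), the `(C1′)` cancellation at the pins, the Lagrange sector `= 0` (INTENT 1 PART B), the `(C2′)` slot sum `= 0` ((δ2b)). -/
theorem sourcePairing_levelOne_closed (hLc : Odd Lc) (cΛ : ℝ) (ν : Fin (d + 1)) (y' : Site (d + 1)) {n : Form1 (d + 1) ℝ} {Bn : ℝ}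
    (hnB : ∀ l t, |n l t| ≤ Bn) (hper : ∀ (l : Fin (d + 1)) (t z : Site (d + 1)), n l (t + (Lc : ℤ) • z) = n l t) (y₀ : Site (d + 1)) :
    ∑ l, ∑' t : Site (d + 1), colH (coDressKBmAt (toSite (ctrOff (d + 1) Lc)) Lc (KInvStep (d := d) Lc (0 + 1))) Lc ν y' l t *
        ∑' ux : Site (d + 1) × Site (d + 1), ∑ κ, ∑ κ₂, n κ ux.1 * dz (fun z : Site (d + 1) => if blk Lc z = y₀ then (1 : ℝ) else 0) κ₂ ux.2 *
          e3OfK Lc (coDressKBmAt (toSite (ctrOff (d + 1) Lc)) Lc (KInvStep (d := d) Lc 0))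
            (S0NAt d Lc (toSite (ctrOff (d + 1) Lc)) ((Lc : ℝ) ^ (d + 1)) (-((Lc : ℝ) ^ (d + 1) * (1 / 2) * (Lc : ℝ) ^ (d + 1))) cΛ) l t ux.1 ux.2 (Sum.inl κ) (Sum.inl κ₂)
      = -(1 / 2 : ℝ) * ∑ l, ∑' t : Site (d + 1), colH (coDressKBmAt (toSite (ctrOff (d + 1) Lc)) Lc (KInvStep (d := d) Lc (0 + 1))) Lc ν y' l t *
            ((if blk Lc (t + unitVec l) = y₀ then (1 : ℝ) else 0)
              * ∑ κ₀, ∑' u : Site (d + 1), n κ₀ u * colM (coDressKBmAt (toSite (ctrOff (d + 1) Lc)) Lc (KInvStep (d := d) Lc 0)) Lc κ₀ u l t)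
        + (1 / 4 : ℝ) * ∑' Y : Site (d + 1), ∑ κ : Fin (d + 1),
            (∑ l, ∑' t : Site (d + 1), colH (coDressKBmAt (toSite (ctrOff (d + 1) Lc)) Lc (KInvStep (d := d) Lc (0 + 1))) Lc ν y' l t
                * colM (coDressKBmAt (toSite (ctrOff (d + 1) Lc)) Lc (KInvStep (d := d) Lc 0)) Lc l t κ Y)
              * (((if blk Lc Y = y₀ then (1 : ℝ) else 0) + (if blk Lc (Y + unitVec κ) = y₀ then (1 : ℝ) else 0)) * n κ Y) := by
  classical
  have hLc1 : 1 ≤ Lc := one_le_of_neZero Lc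
  have hr := ctrOff_mem_box (d := d + 1) hLc1
  have hL : (Lc : ℝ) ^ (d + 1) ≠ 0 := pow_ne_zero _ (by exact_mod_cast NeZero.ne Lc)
  obtain ⟨δG, CG, hδG, hCG, hG⟩ := decays_coDressKBmAt_KInvStep (d := d) hr 0
  -- data: the slot datum is summable along every direction, the label is bounded by `1`
  have hh : ∀ l, Summable fun t : Site (d + 1) => colH (coDressKBmAt (toSite (ctrOff (d + 1) Lc)) Lc (KInvStep (d := d) Lc (0 + 1))) Lc ν y' l t :=
    fun l => summable_colH hr (0 + 1) ν y' l
  have hφ : ∀ z : Site (d + 1), |(fun z : Site (d + 1) => if blk Lc z = y₀ then (1 : ℝ) else 0) z| ≤ 1 := fun z => by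
    by_cases hz : blk Lc z = y₀ <;> simp [hz]
  have hn' : ∀ (κ : Fin (d + 1)) (u : Site (d + 1)), |n κ u| ≤ Bn := hnB
  have hBn : 0 ≤ Bn := (abs_nonneg _).trans (hnB 0 0)
  -- (0) the three sectors; the Lagrange sector vanishes
  rw [slotSum_S0NAt_eq_sectors hr _ _ cΛ hh hnB hφ, lambdaSector_twoLevel_eq_zero (d := d) hLc 0 ν y' hnB hper y₀, mul_zero, add_zero]
  -- (1) the Wilson and border sectors per slot
  have hW := fun (l : Fin (d + 1)) (t : Site (d + 1)) => (hasSum_prod_gaugeLeg_e3OfK_wilsonA_zero_ctr (d := d) (Lc := Lc) l t hn' hφ).tsum_eq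
  have hV := fun (l : Fin (d + 1)) (t : Site (d + 1)) => (hasSum_prod_gaugeLeg_e3OfK_vhSAt hr 0 l t hn' hφ).tsum_eq
  -- summability of the two slot families (the pushed families are local)
  obtain ⟨C1, δ1, hδ1, hT1⟩ := locStencil_e3OfK (N := Lc) hLc1 ⟨δG, CG, hδG, hCG, hG⟩ (locStencil_wilsonA (d := d) zero_le_one) one_pos
  obtain ⟨C2, δ2, hδ2, hT2⟩ := locStencil_e3OfK (N := Lc) hLc1 ⟨δG, CG, hδG, hCG, hG⟩ (locStencil_vhSAt hLc1 hr zero_le_one) one_pos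
  have hsW := fun l => summable_slot_mul_legPairing hT1 hδ1 hn' hφ hh l
  have hsV := fun l => summable_slot_mul_legPairing hT2 hδ2 hn' hφ hh l
  simp only [hW] at hsW
  simp only [hV] at hsV
  simp only [hW, hV]
  -- the border sector's `C_0 n` in the Wilson sector's letters (exchange symmetry of the multiplier column)
  have hCn : ∀ (μ : Fin (d + 1)) (Y : Site (d + 1)), (∑ κ, ∑' u : Site (d + 1), n κ u * colM (coDressKBmAt (toSite (ctrOff (d + 1) Lc)) Lc (KInvStep (d := d) Lc 0)) Lc μ Y κ u)
      = ∑ κ₀, ∑' u : Site (d + 1), n κ₀ u * colM (coDressKBmAt (toSite (ctrOff (d + 1) Lc)) Lc (KInvStep (d := d) Lc 0)) Lc κ₀ u μ Y :=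
    fun μ Y => Finset.sum_congr rfl fun κ _ => tsum_congr fun u => by rw [colM_coDressKBmAt_KInvStep_swap]
  simp only [hCn] at hsV ⊢
  -- abbreviations for the per-slot objects
  set G : MKer (d + 1) (Fib d) := coDressKBmAt (toSite (ctrOff (d + 1) Lc)) Lc (KInvStep (d := d) Lc 0) with hGdef
  set h : Form1 (d + 1) ℝ := fun l t => colH (coDressKBmAt (toSite (ctrOff (d + 1) Lc)) Lc (KInvStep (d := d) Lc (0 + 1))) Lc ν y' l t with hhdef
  set φ : Site (d + 1) → ℝ := fun z => if blk Lc z = y₀ then (1 : ℝ) else 0 with hφdef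
  set Cn : Fin (d + 1) → Site (d + 1) → ℝ := fun κ Y => ∑ κ₀, ∑' u : Site (d + 1), n κ₀ u * colM G Lc κ₀ u κ Y with hCndef
  set U : Fin (d + 1) → Site (d + 1) → ℝ := fun κ Y =>
    (∑ b ∈ box (d + 1) Lc, ∑ s ∈ Finset.range Lc, (if Lc ≤ b κ + s then
        (∑ κ₀, ∑' u : Site (d + 1), n κ₀ u * colH G Lc κ₀ u κ ((Lc : ℤ) • Y + toSite b + (s : ℤ) • unitVec κ)) else 0))
      - ∑ b ∈ box (d + 1) Lc, ∑ s ∈ Finset.range Lc, (if b κ + s + 1 < Lc then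
        (∑ κ₀, ∑' u : Site (d + 1), n κ₀ u * colH G Lc κ₀ u κ ((Lc : ℤ) • Y + toSite b + (s : ℤ) • unitVec κ)) else 0) with hUdef
  show ((Lc : ℝ) ^ (d + 1) * ∑ l, ∑' t : Site (d + 1), h l t *
        ((stepScale d Lc 0 * (Lc : ℝ) ^ (d + 1))⁻¹ *
          (-(1 / 2 : ℝ) * ((stepScale d Lc 0)⁻¹ * (φ (t + unitVec l) * Cn l t)
              - ∑' Y : Site (d + 1), ∑ κ : Fin (d + 1), Cn κ Y * (dz φ κ Y * ∑ b ∈ box (d + 1) Lc, ∑ s ∈ Finset.range Lc, (if b κ + s + 1 < Lc then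
                  colH G Lc l t κ ((Lc : ℤ) • Y + toSite b + (s : ℤ) • unitVec κ) else 0)))
            + (1 / 4 : ℝ) * ((stepScale d Lc 0)⁻¹ * (∑' Y : Site (d + 1), ∑ κ : Fin (d + 1), colM G Lc l t κ Y * ((φ Y + φ (Y + unitVec κ)) * n κ Y))
              + ∑' Y : Site (d + 1), ∑ κ : Fin (d + 1), colM G Lc l t κ Y * (dz φ κ Y * U κ Y))))
      + -((Lc : ℝ) ^ (d + 1) * (1 / 2) * (Lc : ℝ) ^ (d + 1)) * ∑ l, ∑' t : Site (d + 1), h l t *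
        ((stepScale d Lc 0 * (Lc : ℝ) ^ (d + 1))⁻¹ * ((Lc : ℝ) ^ (d + 1))⁻¹ *
          ∑' Y : Site (d + 1), ∑ κ : Fin (d + 1), Cn κ Y * (dz φ κ Y * ∑ b ∈ box (d + 1) Lc, ∑ s ∈ Finset.range Lc, (if b κ + s + 1 < Lc then
              colH G Lc l t κ ((Lc : ℤ) • Y + toSite b + (s : ℤ) • unitVec κ) else 0))))
      = -(1 / 2 : ℝ) * ∑ l, ∑' t : Site (d + 1), h l t * (φ (t + unitVec l) * Cn l t)
        + (1 / 4 : ℝ) * ∑' Y : Site (d + 1), ∑ κ : Fin (d + 1), (∑ l, ∑' t : Site (d + 1), h l t * colM G Lc l t κ Y) * ((φ Y + φ (Y + unitVec κ)) * n κ Y)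
  -- bounds: `C_0 n`, `H_0 n`, `U`, the multiplier columns of `G_0`
  obtain ⟨BC, hBC0, hCb⟩ := abs_multResponse_le (d := d) hr 0 hn'
  have hCb' : ∀ κ Y, |Cn κ Y| ≤ BC := fun κ Y => (hCb κ Y).2
  obtain ⟨BH, hBH0, hHb⟩ := abs_fieldResponse_le' (d := d) hr 0 hn'
  have hUb : ∀ κ Y, |U κ Y| ≤ (box (d + 1) Lc).card * ((Finset.range Lc).card * BH) + (box (d + 1) Lc).card * ((Finset.range Lc).card * BH) := by
    intro κ Y
    refine (abs_sub _ _).trans (add_le_add ?_ ?_)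
    · exact abs_boxSum_ite_le _ _ hBH0 fun b s => hHb κ _
    · exact abs_boxSum_ite_le _ _ hBH0 fun b s => hHb κ _
  have hcol : ∀ (l : Fin (d + 1)) (t : Site (d + 1)) (κ : Fin (d + 1)) (Y : Site (d + 1)), |colM G Lc l t κ Y| ≤ CG * Real.exp (-δG * l1 (Y - t)) :=
    fun l t κ Y => abs_colM_le_fine (N := Lc) hG hδG.le l t κ Y
  have hw1 : ∀ (κ : Fin (d + 1)) (Y : Site (d + 1)), |(φ Y + φ (Y + unitVec κ)) * n κ Y| ≤ 2 * Bn := fun κ Y => by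
    rw [abs_mul]
    have h1 : |φ Y + φ (Y + unitVec κ)| ≤ 2 := ((abs_add_le _ _).trans (add_le_add (hφ Y) (hφ (Y + unitVec κ)))).trans (by norm_num)
    calc |φ Y + φ (Y + unitVec κ)| * |n κ Y| ≤ 2 * Bn := mul_le_mul h1 (hnB κ Y) (abs_nonneg _) (by norm_num)
      _ = 2 * Bn := rfl
  have hw2 : ∀ (κ : Fin (d + 1)) (Y : Site (d + 1)), |dz φ κ Y * U κ Y|
      ≤ 2 * ((box (d + 1) Lc).card * ((Finset.range Lc).card * BH) + (box (d + 1) Lc).card * ((Finset.range Lc).card * BH)) := fun κ Y => by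
    rw [abs_mul]
    exact mul_le_mul ((KKTFluctuationEnergy.abs_dz_le hφ κ Y).trans (by norm_num)) (hUb κ Y) (abs_nonneg _) (by norm_num)
  -- (2) combine the two sectors into one slot sum and do the pin algebra per slot
  have hsA : ∀ l, Summable fun t : Site (d + 1) => h l t * (φ (t + unitVec l) * Cn l t) := fun l =>
    (summable_bdd_mul (hh l) (fun t => show |φ (t + unitVec l) * Cn l t| ≤ 1 * BC by
      rw [abs_mul]; exact mul_le_mul (hφ _) (hCb' l t) (abs_nonneg _) zero_le_one)).congr fun t => by ring
  have hsM : ∀ l, Summable fun t : Site (d + 1) => h l t * ∑' Y : Site (d + 1), ∑ κ, colM G Lc l t κ Y * ((φ Y + φ (Y + unitVec κ)) * n κ Y) :=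
    fun l => summable_slot_mul_tsum_sum hδG hCG hcol hh hw1 l
  have hsD : ∀ l, Summable fun t : Site (d + 1) => h l t * ∑' Y : Site (d + 1), ∑ κ, colM G Lc l t κ Y * (dz φ κ Y * U κ Y) :=
    fun l => summable_slot_mul_tsum_sum hδG hCG hcol hh hw2 l
  have hpin : ∀ (A C1 M C2 : ℝ),
      (Lc : ℝ) ^ (d + 1) * ((stepScale d Lc 0 * (Lc : ℝ) ^ (d + 1))⁻¹ *
          (-(1 / 2 : ℝ) * ((stepScale d Lc 0)⁻¹ * A - C1) + (1 / 4 : ℝ) * ((stepScale d Lc 0)⁻¹ * M + C2)))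
        + -((Lc : ℝ) ^ (d + 1) * (1 / 2) * (Lc : ℝ) ^ (d + 1)) * ((stepScale d Lc 0 * (Lc : ℝ) ^ (d + 1))⁻¹ * ((Lc : ℝ) ^ (d + 1))⁻¹ * C1)
        = -(1 / 2 : ℝ) * A + (1 / 4 : ℝ) * M + (1 / 4 : ℝ) * C2 := by
    intro A C1 M C2
    rw [stepScale_zero]
    field_simp
    ring
  have e2 : ((Lc : ℝ) ^ (d + 1) * ∑ l, ∑' t : Site (d + 1), h l t *
        ((stepScale d Lc 0 * (Lc : ℝ) ^ (d + 1))⁻¹ *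
          (-(1 / 2 : ℝ) * ((stepScale d Lc 0)⁻¹ * (φ (t + unitVec l) * Cn l t)
              - ∑' Y : Site (d + 1), ∑ κ : Fin (d + 1), Cn κ Y * (dz φ κ Y * ∑ b ∈ box (d + 1) Lc, ∑ s ∈ Finset.range Lc, (if b κ + s + 1 < Lc then
                  colH G Lc l t κ ((Lc : ℤ) • Y + toSite b + (s : ℤ) • unitVec κ) else 0)))
            + (1 / 4 : ℝ) * ((stepScale d Lc 0)⁻¹ * (∑' Y : Site (d + 1), ∑ κ : Fin (d + 1), colM G Lc l t κ Y * ((φ Y + φ (Y + unitVec κ)) * n κ Y))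
              + ∑' Y : Site (d + 1), ∑ κ : Fin (d + 1), colM G Lc l t κ Y * (dz φ κ Y * U κ Y))))
      + -((Lc : ℝ) ^ (d + 1) * (1 / 2) * (Lc : ℝ) ^ (d + 1)) * ∑ l, ∑' t : Site (d + 1), h l t *
        ((stepScale d Lc 0 * (Lc : ℝ) ^ (d + 1))⁻¹ * ((Lc : ℝ) ^ (d + 1))⁻¹ *
          ∑' Y : Site (d + 1), ∑ κ : Fin (d + 1), Cn κ Y * (dz φ κ Y * ∑ b ∈ box (d + 1) Lc, ∑ s ∈ Finset.range Lc, (if b κ + s + 1 < Lc then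
              colH G Lc l t κ ((Lc : ℤ) • Y + toSite b + (s : ℤ) • unitVec κ) else 0))))
      = ∑ l, ∑' t : Site (d + 1), h l t * (-(1 / 2 : ℝ) * (φ (t + unitVec l) * Cn l t)
          + (1 / 4 : ℝ) * (∑' Y : Site (d + 1), ∑ κ : Fin (d + 1), colM G Lc l t κ Y * ((φ Y + φ (Y + unitVec κ)) * n κ Y))
          + (1 / 4 : ℝ) * (∑' Y : Site (d + 1), ∑ κ : Fin (d + 1), colM G Lc l t κ Y * (dz φ κ Y * U κ Y))) := by
    rw [Finset.mul_sum, Finset.mul_sum, ← Finset.sum_add_distrib]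
    refine Finset.sum_congr rfl fun l _ => ?_
    rw [← tsum_mul_left, ← tsum_mul_left, ← Summable.tsum_add ((hsW l).mul_left _) ((hsV l).mul_left _)]
    refine tsum_congr fun t => ?_
    linear_combination (h l t) * hpin (φ (t + unitVec l) * Cn l t)
      (∑' Y : Site (d + 1), ∑ κ : Fin (d + 1), Cn κ Y * (dz φ κ Y * ∑ b ∈ box (d + 1) Lc, ∑ s ∈ Finset.range Lc, (if b κ + s + 1 < Lc then
          colH G Lc l t κ ((Lc : ℤ) • Y + toSite b + (s : ℤ) • unitVec κ) else 0)))
      (∑' Y : Site (d + 1), ∑ κ : Fin (d + 1), colM G Lc l t κ Y * ((φ Y + φ (Y + unitVec κ)) * n κ Y))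
      (∑' Y : Site (d + 1), ∑ κ : Fin (d + 1), colM G Lc l t κ Y * (dz φ κ Y * U κ Y))
  rw [e2]
  -- (3) split the slot sum into its three terms
  have e3 : (∑ l, ∑' t : Site (d + 1), h l t * (-(1 / 2 : ℝ) * (φ (t + unitVec l) * Cn l t)
          + (1 / 4 : ℝ) * (∑' Y : Site (d + 1), ∑ κ : Fin (d + 1), colM G Lc l t κ Y * ((φ Y + φ (Y + unitVec κ)) * n κ Y))
          + (1 / 4 : ℝ) * (∑' Y : Site (d + 1), ∑ κ : Fin (d + 1), colM G Lc l t κ Y * (dz φ κ Y * U κ Y))))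
      = -(1 / 2 : ℝ) * ∑ l, ∑' t : Site (d + 1), h l t * (φ (t + unitVec l) * Cn l t)
        + (1 / 4 : ℝ) * ∑ l, ∑' t : Site (d + 1), h l t * ∑' Y : Site (d + 1), ∑ κ : Fin (d + 1), colM G Lc l t κ Y * ((φ Y + φ (Y + unitVec κ)) * n κ Y)
        + (1 / 4 : ℝ) * ∑ l, ∑' t : Site (d + 1), h l t * ∑' Y : Site (d + 1), ∑ κ : Fin (d + 1), colM G Lc l t κ Y * (dz φ κ Y * U κ Y) := by
    rw [Finset.mul_sum, Finset.mul_sum, Finset.mul_sum, ← Finset.sum_add_distrib, ← Finset.sum_add_distrib]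
    refine Finset.sum_congr rfl fun l _ => ?_
    rw [← tsum_mul_left, ← tsum_mul_left, ← tsum_mul_left, ← Summable.tsum_add ((hsA l).mul_left _) ((hsM l).mul_left _),
      ← Summable.tsum_add (((hsA l).mul_left _).add ((hsM l).mul_left _)) ((hsD l).mul_left _)]
    exact tsum_congr fun t => by ring
  rw [e3]
  -- (4) the two slot × bond Fubinis
  rw [slotSum_tsum_sum_mul_eq hδG hCG hcol hh hw1, slotSum_tsum_sum_mul_eq hδG hCG hcol hh hw2]
  -- (5) the `(C2′)` term vanishes: `C_0 h` in the `wΦ` letters, then (δ2b)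
  have hC0h : ∀ (κ : Fin (d + 1)) (Y : Site (d + 1)), (∑ l, ∑' t : Site (d + 1), h l t * colM G Lc l t κ Y)
      = ∑' t : Site (d + 1), ∑ l, wΦ (N := Lc ^ (0 + 1)) κ l (Y - t) * h l t := fun κ Y => by
    rw [hGdef]; exact slotSum_mul_colM_eq hr 0 hh κ Y
  have hD := twoLevel_defect_eq_zero (d := d) hLc 0 ν y' hnB hper y₀
  have e5 : (∑' Y : Site (d + 1), ∑ κ : Fin (d + 1), (∑ l, ∑' t : Site (d + 1), h l t * colM G Lc l t κ Y) * (dz φ κ Y * U κ Y)) = 0 := by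
    refine Eq.trans ?_ hD
    refine tsum_congr fun Y => Finset.sum_congr rfl fun κ _ => ?_
    rw [hC0h κ Y]
    simp only [hhdef, hφdef, hUdef, hGdef, dz]
    ring
  rw [e5, mul_zero, add_zero]

end Summit.QuantumFields.BalabanUV.Beta.GAN24.SourcePairingLevelOneClosed

end
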